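import Mathlib.Data.Finset.Sups
import Mathlib.Order.UpperLower.Basic
import Summits.CriticalPhenomena.PercolationContinuityZ3.Theorems.PercNearOneGluingNoHeavyLowerTailAntiBandThreshold

/-!
# `NoHeavyLowerTail` (crux stmt-CriticalPhenomena-4575), lane prim-ineq-gen-4 (gen 33): the anti-band inequality for EVERY symmetric threshold junta (any arity)

Support file (`--supports stmt-CriticalPhenomena-4575`; memo `run/shared/lean/prim/prim-ineq-gen-4/FINDING-THRESHOLD-JUNTA-g33.md` §1.4).
Pure finite combinatorics, no definitions, no `sorry`, standard axioms.

`AntiBandThreshold.antiBand_threshold_left/right` prove (AB_l)(n) (`n ≥ 2l ≥ 2`) for the pairs `(Th, B)`, `(B, Th)` with `Th = {s | k ≤ #(s ∩ T₀)}` under the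
hypothesis `#T₀ < 2k` (the "intersecting core" case).  This file removes that hypothesis: for `#T₀ ≥ 2k` the outer members `s` of `Th` with `#(s ∩ T₀) ≤ #T₀ − k`
have their complements again in that part of `Th`, so `s ↦ sᶜ` shows they contribute equally to both sides of (AB); the remaining members form the threshold
junta with `k' = #T₀ − k + 1 > #T₀ / 2`, to which the core theorem applies (`antiBand_threshold_left_all`, `antiBand_threshold_right_all`).  Hence (AB_l)(n) holds
in every cell for every pair of up-sets one of which is a symmetric threshold function ("at least `k` of the coordinates `T₀`") of any arity — dictators,
AND/OR of a block, majorities, and all intermediate thresholds.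
-/

namespace Summit.CriticalPhenomena.PercolationContinuityZ3.Theorems.AntiBandThresholdAll

open Finset
open scoped FinsetFamily

/-- **(AB_l)(n) for EVERY symmetric threshold junta on the left (any arity).**  For `1 ≤ l`, `2l ≤ n`, any `T₀ : Finset (Fin n)`, any `k`, and
any up-set `V`: `#{s ∈ Th ∩ Vᶜˢ | #s < l ∨ #sᶜ < l} ≤ #{s ∈ Th ∩ V | #s < l ∨ #sᶜ < l}`, `Th = {s | k ≤ #(s ∩ T₀)}`.  If `#T₀ < 2k` this is
`AntiBandThreshold.antiBand_threshold_left`; otherwise the outer members `s` of `Th` with `#(s ∩ T₀) ≤ #T₀ − k` come in complementary pairs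
(contributing equally to both sides) and the rest is the threshold junta with `k' = #T₀ − k + 1`, `#T₀ < 2k'`. [this work; memo FINDING-THRESHOLD-JUNTA-g33 §1.4] -/
theorem antiBand_threshold_left_all {n : ℕ} (l : ℕ) (hl : 1 ≤ l) (h2l : 2 * l ≤ n) (T₀ : Finset (Fin n)) (k : ℕ)
    (V : Finset (Finset (Fin n))) (hV : IsUpperSet (V : Set (Finset (Fin n)))) :
    #(((univ.filter fun s : Finset (Fin n) => k ≤ #(s ∩ T₀)) ∩ Vᶜˢ).filter fun s => #s < l ∨ #sᶜ < l)
      ≤ #(((univ.filter fun s : Finset (Fin n) => k ≤ #(s ∩ T₀)) ∩ V).filter fun s => #s < l ∨ #sᶜ < l) := by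
  classical
  by_cases hkt : #T₀ < 2 * k
  · exact AntiBandThreshold.antiBand_threshold_left l hl h2l T₀ k hkt V hV
  rw [not_lt] at hkt
  set t : ℕ := #T₀ with htdef
  set k' : ℕ := t - k + 1 with hk'def
  have hk't : t < 2 * k' := by omega
  set W : Finset (Finset (Fin n)) := univ.filter fun s => k ≤ #(s ∩ T₀) with hWdef
  set W₂ : Finset (Finset (Fin n)) := univ.filter fun s => k' ≤ #(s ∩ T₀) with hW₂def
  have hT₀sd : ∀ s : Finset (Fin n), #(sᶜ ∩ T₀) + #(s ∩ T₀) = t := fun s => by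
    have h1 : sᶜ ∩ T₀ = T₀ \ s := by ext x; rw [mem_inter, mem_compl, mem_sdiff]; tauto
    rw [h1, inter_comm]; exact card_sdiff_add_card_inter T₀ s
  -- split the outer part of `W ∩ X` by the predicate `k' ≤ #(s ∩ T₀)`
  have hsplit : ∀ X : Finset (Finset (Fin n)),
      #((W ∩ X).filter fun s => #s < l ∨ #sᶜ < l) =
        #((W₂ ∩ X).filter fun s => #s < l ∨ #sᶜ < l) +
        #(((W ∩ X).filter fun s => #s < l ∨ #sᶜ < l).filter fun s => ¬ k' ≤ #(s ∩ T₀)) := by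
    intro X
    rw [← card_filter_add_card_filter_not (fun s => k' ≤ #(s ∩ T₀))]
    congr 2
    ext s
    rw [mem_filter, mem_filter, mem_filter, mem_inter, mem_inter, hWdef, hW₂def, mem_filter, mem_filter]
    constructor
    · rintro ⟨⟨⟨⟨-, -⟩, hX⟩, hO⟩, hp⟩; exact ⟨⟨⟨mem_univ _, hp⟩, hX⟩, hO⟩
    · rintro ⟨⟨⟨-, hp⟩, hX⟩, hO⟩; exact ⟨⟨⟨⟨mem_univ _, by omega⟩, hX⟩, hO⟩, hp⟩
  -- the complementary-pair part has the same size on both sides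
  have hpair : #(((W ∩ Vᶜˢ).filter fun s => #s < l ∨ #sᶜ < l).filter fun s => ¬ k' ≤ #(s ∩ T₀)) =
      #(((W ∩ V).filter fun s => #s < l ∨ #sᶜ < l).filter fun s => ¬ k' ≤ #(s ∩ T₀)) := by
    refine card_bij (fun s _ => sᶜ) (fun s hs => ?_) (fun s _ s' _ h => compl_injective h) (fun s hs => ⟨sᶜ, ?_, compl_compl s⟩)
    · rw [mem_filter, mem_filter, mem_inter, mem_compls, hWdef, mem_filter] at hs
      obtain ⟨⟨⟨⟨-, hk⟩, hV'⟩, hO⟩, hp⟩ := hs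
      have h1 := hT₀sd s
      rw [mem_filter, mem_filter, mem_inter, hWdef, mem_filter, compl_compl]
      exact ⟨⟨⟨⟨mem_univ _, by omega⟩, hV'⟩, hO.symm⟩, by omega⟩
    · rw [mem_filter, mem_filter, mem_inter, hWdef, mem_filter] at hs
      obtain ⟨⟨⟨⟨-, hk⟩, hV'⟩, hO⟩, hp⟩ := hs
      have h1 := hT₀sd s
      rw [mem_filter, mem_filter, mem_inter, mem_compls, hWdef, mem_filter, compl_compl]
      exact ⟨⟨⟨⟨mem_univ _, by omega⟩, hV'⟩, hO.symm⟩, by omega⟩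
  rw [hsplit Vᶜˢ, hsplit V, hpair]
  exact Nat.add_le_add_right (AntiBandThreshold.antiBand_threshold_left l hl h2l T₀ k' hk't V hV) _

/-- **(AB_l)(n) for EVERY symmetric threshold junta on the right (any arity)** — complement symmetry + the left version. [this work] -/
theorem antiBand_threshold_right_all {n : ℕ} (l : ℕ) (hl : 1 ≤ l) (h2l : 2 * l ≤ n) (A : Finset (Finset (Fin n)))
    (hA : IsUpperSet (A : Set (Finset (Fin n)))) (T₀ : Finset (Fin n)) (k : ℕ) :
    #((A ∩ (univ.filter fun s : Finset (Fin n) => k ≤ #(s ∩ T₀))ᶜˢ).filter fun s => #s < l ∨ #sᶜ < l)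
      ≤ #((A ∩ (univ.filter fun s : Finset (Fin n) => k ≤ #(s ∩ T₀))).filter fun s => #s < l ∨ #sᶜ < l) := by
  classical
  have hsymm : ∀ B : Finset (Finset (Fin n)),
      #((A ∩ Bᶜˢ).filter fun s => #s < l ∨ #sᶜ < l) = #((B ∩ Aᶜˢ).filter fun s => #s < l ∨ #sᶜ < l) := by
    intro B
    refine card_bij (fun s _ => sᶜ) (fun s hs => ?_) (fun s _ t _ h => compl_injective h) (fun t ht => ⟨tᶜ, ?_, compl_compl t⟩)
    · rw [mem_filter, mem_inter, mem_compls] at hs ⊢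
      rw [compl_compl]; exact ⟨⟨hs.1.2, hs.1.1⟩, hs.2.symm⟩
    · rw [mem_filter, mem_inter, mem_compls] at ht ⊢
      rw [compl_compl]; exact ⟨⟨ht.1.2, ht.1.1⟩, ht.2.symm⟩
  rw [hsymm, inter_comm A]
  exact antiBand_threshold_left_all l hl h2l T₀ k A hA

end Summit.CriticalPhenomena.PercolationContinuityZ3.Theorems.AntiBandThresholdAll
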